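import Literature.AlgebraicGeometry.AbelianSchemes.PolarizedAbelianSchemeWithLevel
import Literature.AlgebraicGeometry.AbelianSchemes.SymplecticLiftChangeLevel
import HarnessLib

/-!
# The level change of a polarised abelian scheme with level structure
# ([MumfordFogartyKirwan1994, App. 7A]; cell hodgecm-mathlib, M1PRIME-DAG rung 0, W2/W1b — the object map of the tower)

[MumfordFogartyKirwan1994, App. 7A (p. 235)] «tower with respect to finite morphisms `𝒜_{nm} → 𝒜_n`»: on objects of
[Def. 7.2] (abelian scheme, polarisation, level structure) the level-lowering map keeps the abelian scheme, the dual pair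
and the polarisation and replaces the level-`N` structure `(σᵢ)` by `(σᵢ ^ d)`, `N = N' d` (★ `LevelStructure.changeLevel`);
symplectic-liftability is preserved (★ `LevelStructure.IsSymplecticLiftable.changeLevel`).  [Deligne1971TravauxShimura,
4.16 (p. 150)]: the functor `F` at the principal levels `K(n)`.  This file records that object map on the D4 carrier
`PolarizedAbelianSchemeWithLevel` together with its two laws (identity along `N = N · 1`, transitivity) as EQUALITIES of
triples, and its NATURALITY for the pull-back relation `IsBaseChangeVia` of [Def. 7.3] (only the level clause moves) —
the inputs from which the transition morphisms of the Siegel tower and their functor laws follow by `classify`.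

## Main definitions and results
* `PolarizedAbelianSchemeWithLevel.changeLevel P N' d (hd : N = N' * d) (hN : N ≠ 0)` — the level change of a triple.
* `changeLevel_self`, `changeLevel_changeLevel` — identity and transitivity (via `mk_eq_mk_of_level_eq`).
* `PolarizedAbelianSchemeWithLevel.IsBaseChangeVia.changeLevel` — naturality for the pull-back relation.

Cell hodgecm-mathlib, #60 Mumford line, rung 0 (director s91 (2): additive module downstream of the D4 (O)(R) carrier);
prover seat B-p09.  HC_CM is proved only modulo the 7 printed citations until rung 0 closes; this file discharges none.

## References
* [MumfordFogartyKirwan1994] Ch. 7 §2 Def. 7.2–7.3 (pp. 129–130), App. 7A (pp. 235–236).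
* [Deligne1971TravauxShimura] 1.8 (p. 129), 4.16 (p. 150).
* Tree: ★ `PolarizedAbelianSchemeWithLevel` (D4 (O)(R)), ★ `SymplecticLiftChangeLevel`, ★ `LevelStructureChangeLevel`.
-/

universe u

open CategoryTheory CategoryTheory.Limits AlgebraicGeometry MonoidalCategory

noncomputable section

namespace Literature.AlgebraicGeometry.AbelianSchemes

namespace PolarizedAbelianSchemeWithLevel

open AbelianSchemeOver

variable {g N : ℕ} {δ : Fin g → ℕ} {S : Scheme.{u}}

/-- **The level change of a polarised abelian scheme with level structure** (the object map of the App. 7A tower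
`𝒜_{g,δ,N} → 𝒜_{g,δ,N'}`, `N = N' d`): same abelian scheme, dual pair, polarisation and type; level structure
`σ ↦ σ^d`; symplectic-liftability by (c5) `IsSymplecticLiftable.changeLevel`. [cite: MumfordFogartyKirwan1994, App. 7A (p. 235)] [cite: Deligne1971TravauxShimura, 4.16 p. 150] -/
def changeLevel (P : PolarizedAbelianSchemeWithLevel g N δ S) (N' d : ℕ) (hd : N = N' * d) (hN : N ≠ 0) :
    PolarizedAbelianSchemeWithLevel g N' δ S where
  A := P.A
  relDim := P.relDim
  D := P.D
  pol := P.pol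
  hasType := P.hasType
  level := P.level.changeLevel N' d hd hN
  symplectic := AbelianSchemeOver.LevelStructure.IsSymplecticLiftable.changeLevel P.symplectic N' d hd hN
  hatNormalised := P.hatNormalised

/-- Two triples with the same underlying data and EQUAL level structures are equal (the `symplectic` field is a
proposition). [folklore] -/
private theorem mk_eq_mk_of_level_eq (P : PolarizedAbelianSchemeWithLevel g N δ S) {N' : ℕ}
    {φ ψ : P.A.LevelStructure g N'} (hφ : φ.IsSymplecticLiftable P.pol δ) (hψ : ψ.IsSymplecticLiftable P.pol δ)
    (h : φ = ψ) :
    (⟨P.A, P.relDim, P.D, P.pol, P.hasType, φ, hφ, P.hatNormalised⟩ : PolarizedAbelianSchemeWithLevel g N' δ S) =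
      ⟨P.A, P.relDim, P.D, P.pol, P.hasType, ψ, hψ, P.hatNormalised⟩ := by
  subst h
  rfl

/-- (c2) at triple level: the level change along `N = N · d` is the identity. [cite: Deligne1971TravauxShimura, 1.8 p. 129] -/
theorem changeLevel_self (P : PolarizedAbelianSchemeWithLevel g N δ S) (d : ℕ) (hd : N = N * d) (hN : N ≠ 0) :
    P.changeLevel N d hd hN = P :=
  mk_eq_mk_of_level_eq P _ P.symplectic (P.level.changeLevel_self d hd hN)

/-- (c3) at triple level: the level change is transitive. [cite: Deligne1971TravauxShimura, 1.8 p. 129] -/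
theorem changeLevel_changeLevel (P : PolarizedAbelianSchemeWithLevel g N δ S) (N' d₁ : ℕ) (h₁ : N = N' * d₁)
    (hN : N ≠ 0) (N'' d₂ : ℕ) (h₂ : N' = N'' * d₂) (hN' : N' ≠ 0) (d₃ : ℕ) (h₃ : N = N'' * d₃) :
    (P.changeLevel N' d₁ h₁ hN).changeLevel N'' d₂ h₂ hN' = P.changeLevel N'' d₃ h₃ hN :=
  mk_eq_mk_of_level_eq P _ _ (P.level.changeLevel_changeLevel N' d₁ h₁ hN N'' d₂ h₂ hN' d₃ h₃)

/-- **(c4) at triple level — the level change is NATURAL for the pull-back relation `IsBaseChangeVia`** (only the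
`level` clause changes; `hat`, Poincaré and `λ` clauses are carried verbatim): the App. 7A tower map is a natural
transformation of the moduli functors of Def. 7.3, hence (by `classify`) a morphism of the representing schemes.
[cite: MumfordFogartyKirwan1994, Ch. 7 §2 Definition 7.3 (p. 129) and App. 7A (p. 235)] -/
theorem IsBaseChangeVia.changeLevel {T : Scheme.{u}} {P' : PolarizedAbelianSchemeWithLevel g N δ T}
    {P : PolarizedAbelianSchemeWithLevel g N δ S} {f : T ⟶ S} {G : P'.A.X.left ⟶ P.A.X.left}
    {Ĝ : P'.D.hat.X.left ⟶ P.D.hat.X.left} (h : P'.IsBaseChangeVia P f G Ĝ)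
    (N' d : ℕ) (hd : N = N' * d) (hN : N ≠ 0) :
    (P'.changeLevel N' d hd hN).IsBaseChangeVia (P.changeLevel N' d hd hN) f G Ĝ :=
  ⟨h.1.changeLevel P.level N' d hd hN, h.2.1, h.2.2.1, h.2.2.2⟩

end PolarizedAbelianSchemeWithLevel

end Literature.AlgebraicGeometry.AbelianSchemes

end
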